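import Summits.BirchSwinnertonDyer.BirchSwinnertonDyer.Theorems.ManinLocalTwoThreeTameThreeNeronScalarIIIstar
import HarnessLib

/-!
# The tame Néron-scalar law at `3` on the `III` stratum, for a RATIONAL `3`-line: the `u = 1` Vélu pair has
# `ord₃ Δ = 9` and is `3`-adically minimal (E-an-107 `TameThreeNeronScalarLawIII`, conjunct 2, PROVED)

Summit `BirchSwinnertonDyer`, route `ManinLocalTwoThree` (cell bsd-f2-manin), crux C3 `ManinPrimeToThreeAtNine`
(stmt-BirchSwinnertonDyer-22968); sibling of `…TameThreeNeronScalarIIIstar` (p642603, the `III*` stratum).  THE STATEMENT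
(`padicValInt_minimalDiscriminantInt_eq_nine_of_velu_three_of_III`): `W/ℚ` globally minimal, TAME at `3` (`9 ∥ N`) with
`ord₃ Δ_min = 3` (Kodaira `III`), `q ∈ ℚ` the short-model abscissa of a rational `3`-line (`Ψ₃(q − b₂/12) = 0`); then EVERY
globally minimal `W'` carrying the `u = 1` Vélu pair `(c₄, c₆)(W') = (1440q² − 9c₄(W), 60480q³ − 756c₄(W)q − 27c₆(W))` has
`ord₃ Δ_min(W') = 9` — the target of a rational `3`-isogeny out of a tame `III` curve, in the `u = 1` normalisation, is of
discriminant valuation `9` (type `III*`), i.e. `u(W → W/C) = 1` at `3` (E-an-107; Dokchitser–Dokchitser 2015 Table 1, `l = p`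
pot.-good row, made explicit over `ℚ₃` for rational kernels); and NO globally minimal curve carries `(3⁻⁴, 3⁻⁶)` times the
Vélu pair (`not_exists_isGloballyMinimal_three_velu_three_of_III`: its discriminant would have `ord₃ = −3`).

THE PROOF: p2's integer `III`-shape (`exists_IIIShape_coeffs_three`: `b₂ = 3β − 12r`, `b₄ = 3γ − 3βr + 6r²`, …, `3 ∤ ε`);
with `y = 4q − β` the root condition is the quartic `y⁴ + 4βy³ + 48γy² + 576δy + 768ε = 0` (§1: `y ∈ ℤ`, `3 ∤ y`,
`y + β = 3σ`), so `q = 3σ/4`, the Vélu pair is `(3⁴P₄, 3⁶P₆)` with `P₄ = 10σ² − β² + 8γ`,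
`P₆ = 35σ³ − 7(β² − 8γ)σ + β³ − 12βγ + 72δ`, and `64·Δ(W') = 3⁹(P₄³ − P₆²)`; the unit `3 ∤ P₄³ − P₆²` is a finite check
over `ZMod 3` (`decide`) of the residues allowed by the root relation `y³(σ + β) = −(16γy² + 192δy + 256ε)` and
`4ε = 3βδ − γ²`.  At `N = 9p` (`p ≡ 2 (mod 3)`), with p3-g6's `velu_three_of_tripled_nine_mul_prime`: if the optimal pair of a
class is TRIPLED and `W₀` is of type `III`, then `ord₃ Δ_min(W₁) = 9` (an's edge `typeIIIstar_of_tripled_of_typeIII`, input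
discharged).

HONEST FRAMING: local theorems about Weierstrass models plus one ledger reading; C3, Manin's conjecture and BSD are not proved.
No definitions, no named facts, no sorry.  Sanity instance: `36a1 = [0,0,0,0,1]` (III), `q = 0`, Vélu pair `(0, 23328)`,
the curve `[0,0,0,0,−27] = 36a3` (III*, `Δ = −2⁴3⁹`).

References: [SilvermanATAEC1994] IV.9.4 Steps 2–4, Table 4.1; [SilvermanAEC2009] III.1, VII.1; J. Vélu, C. R. Acad. Sci.
Paris 273 (1971); [DokchitserDokchitser2015LocalInvariants] Table 1; cell memo HOME/MEMO-an.md §66 (E-an-107, census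
HOME/an/g24/tame3-neron-census.out: 8 650 / 8 650 `III → III*` edges, all `u = 1`).
-/

set_option linter.dupNamespace false
set_option autoImplicit false

noncomputable section

open scoped Classical

open WeierstrassCurve IsDedekindDomain NumberField Rat.HeightOneSpectrum Polynomial
  Literature.NumberTheory.DiophantineGeometry Literature.NumberTheory.EllipticCurves
  Literature.NumberTheory.EllipticCurves.ModularForms CongruenceSubgroup
  Summit.BirchSwinnertonDyer.Rank1Residual.Additive

namespace Summit.BirchSwinnertonDyer.BirchSwinnertonDyer.Theorems.ManinLocalTwoThree

/-! ### §1. The rational root of the tame quartic `y⁴ + 4βy³ + 48γy² + 576δy + 768ε`, `3 ∤ ε` -/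

/-- **The `3`-adic position of a rational root of the tame quartic.**  If `y ∈ ℚ` satisfies
`y⁴ + 4βy³ + 48γy² + 576δy + 768ε = 0` with `3 ∤ ε`, then `y ∈ ℤ`, `3 ∤ y` and `y + β = 3σ` for some `σ ∈ ℤ`
(rational root of a monic integer quartic; `3 ∣ y` would force `9 ∣ 768ε`; `y³(y + 4β) ≡ 0 (mod 3)`).
[cite: SilvermanATAEC1994, IV.9.4 Steps 2–4 (type III)] -/
theorem exists_int_of_tameQuartic_root {β γ δ ε : ℤ} (hε : ¬ (3 : ℤ) ∣ ε) {y : ℚ}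
    (hy : y ^ 4 + 4 * β * y ^ 3 + 48 * γ * y ^ 2 + 576 * δ * y + 768 * ε = 0) :
    ∃ Y σ : ℤ, y = (Y : ℚ) ∧ Y + β = 3 * σ ∧ ¬ (3 : ℤ) ∣ Y ∧
      Y ^ 4 + 4 * β * Y ^ 3 + 48 * γ * Y ^ 2 + 576 * δ * Y + 768 * ε = 0 := by
  set P : ℤ[X] := X ^ 4 + (C (4 * β) * X ^ 3 + C (48 * γ) * X ^ 2 + C (576 * δ) * X + C (768 * ε)) with hP
  have hmonic : P.Monic := by
    refine (monic_X_pow 4).add_of_left (lt_of_le_of_lt degree_cubic_le ?_)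
    rw [degree_X_pow]; norm_num
  have haeval : aeval y P = 0 := by
    rw [← hy, hP]
    simp only [map_add, map_mul, map_pow, aeval_X, map_ofNat, map_intCast, eq_intCast]
    ring
  obtain ⟨Y, hY⟩ := isInteger_of_is_root_of_monic hmonic haeval
  have hYy : (Y : ℚ) = y := by simpa using hY
  have hYeq : Y ^ 4 + 4 * β * Y ^ 3 + 48 * γ * Y ^ 2 + 576 * δ * Y + 768 * ε = 0 := by
    have h : ((Y ^ 4 + 4 * β * Y ^ 3 + 48 * γ * Y ^ 2 + 576 * δ * Y + 768 * ε : ℤ) : ℚ) = 0 := by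
      push_cast; rw [hYy]; exact hy
    exact_mod_cast h
  have hY3 : ¬ (3 : ℤ) ∣ Y := by
    rintro ⟨w, rfl⟩
    have h : 768 * ε = -9 * (9 * w ^ 4 + 12 * β * w ^ 3 + 48 * γ * w ^ 2 + 192 * δ * w) := by
      linear_combination hYeq
    exact hε (by omega)
  have h3 : (3 : ℤ) ∣ Y ^ 3 * (Y + 4 * β) :=
    ⟨-(16 * γ * Y ^ 2 + 192 * δ * Y + 256 * ε), by linear_combination hYeq⟩
  rcases Int.prime_three.dvd_or_dvd h3 with h | h
  · exact absurd (Int.prime_three.dvd_of_dvd_pow h) hY3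
  obtain ⟨κ, hκ⟩ := h
  exact ⟨Y, κ - β, hYy.symm, by linear_combination hκ, hY3, hYeq⟩

/-! ### §2. The unit: a finite check over `ZMod 3` -/

/-- The residues mod `3` allowed by the root relation make `P₄³ − P₆²` a unit (finite check). -/
private theorem unit_III_decide : ∀ b g s d e y : ZMod 3, e ≠ 0 → y ≠ 0 → y = 3 * s - b →
    4 * e = 3 * b * d - g ^ 2 → y ^ 3 * (s + b) + 16 * g * y ^ 2 + 192 * d * y + 256 * e = 0 →
    (10 * s ^ 2 - b ^ 2 + 8 * g) ^ 3 - (35 * s ^ 3 - 7 * (b ^ 2 - 8 * g) * s + b ^ 3 - 12 * b * g + 72 * d) ^ 2 ≠ 0 := by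
  decide

/-! ### §3. The discriminant of any carrier of the Vélu pair on the `III` stratum -/

/-- **The Vélu pair of a rational `3`-line on a tame `III` curve has discriminant `3⁹ × unit / 64`.**  For `W/ℚ` globally
minimal with `9 ∥ N`, `ord₃ Δ_min = 3` and `Ψ₃(q − b₂/12) = 0` there is an integer `U`, `3 ∤ U`, such that EVERY
Weierstrass curve `T/ℚ` with `c₄(T) = 1440q² − 9c₄(W)`, `c₆(T) = 60480q³ − 756c₄(W)q − 27c₆(W)` has `64·Δ(T) = 3⁹·U`
(`U = P₄³ − P₆²`, module docstring). [cite: SilvermanATAEC1994, IV.9.4 Steps 2–4 and Table 4.1] -/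
theorem exists_unit_velu_three_Δ_of_III (W : WeierstrassCurve ℚ) [W.IsElliptic] [W.IsGloballyMinimal]
    (h9 : 3 ^ 2 ∣ W.conductorNorm ℤ) (h27 : ¬ 3 ^ 3 ∣ W.conductorNorm ℤ)
    (hΔ : padicValInt 3 W.minimalDiscriminantInt = 3) (q : ℚ) (hq : W.Ψ₃.eval (q - W.b₂ / 12) = 0) :
    ∃ U : ℤ, ¬ (3 : ℤ) ∣ U ∧ ∀ T : WeierstrassCurve ℚ, T.c₄ = 1440 * q ^ 2 - 9 * W.c₄ →
      T.c₆ = 60480 * q ^ 3 - 756 * W.c₄ * q - 27 * W.c₆ → 64 * T.Δ = 3 ^ 9 * (U : ℚ) := by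
  obtain ⟨r, β, γ, δ, ε, hε3, hb₂, hb₄, hb₆, hb₈⟩ := exists_IIIShape_coeffs_three W h9 h27 hΔ
  -- `4ε = 3βδ − γ²` from `4b₈ = b₂b₆ − b₄²`
  have hε : 4 * ε = 3 * β * δ - γ ^ 2 := by
    have h := W.b_relation
    rw [hb₂, hb₄, hb₆, hb₈] at h
    have h' : ((4 * ε : ℤ) : ℚ) = ((3 * β * δ - γ ^ 2 : ℤ) : ℚ) := by push_cast; linear_combination h / 9
    exact_mod_cast h'
  have hc₄ : W.c₄ = 9 * ((β : ℚ) ^ 2 - 8 * γ) := by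
    simp only [WeierstrassCurve.c₄]; rw [hb₂, hb₄]; ring
  have hc₆ : W.c₆ = -27 * ((β : ℚ) ^ 3 - 12 * β * γ + 72 * δ) := by
    simp only [WeierstrassCurve.c₆]; rw [hb₂, hb₄, hb₆]; ring
  -- the root, rescaled: `y = 4q − β`
  have hy : (4 * q - β) ^ 4 + 4 * β * (4 * q - β) ^ 3 + 48 * γ * (4 * q - β) ^ 2 +
      576 * δ * (4 * q - β) + 768 * ε = 0 := by
    simp only [WeierstrassCurve.Ψ₃, eval_add, eval_mul, eval_pow, eval_C, eval_X, eval_ofNat] at hq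
    rw [hb₂, hb₄, hb₆, hb₈] at hq
    linear_combination (256 / 3 : ℚ) * hq
  obtain ⟨Y, σ, hyY, hσ, hY3, hYeq⟩ := exists_int_of_tameQuartic_root hε3 hy
  have hq' : q = 3 * (σ : ℚ) / 4 := by
    have hσ' : ((Y + β : ℤ) : ℚ) = 3 * σ := by exact_mod_cast hσ
    push_cast at hσ'
    linear_combination hyY / 4 + hσ' / 4
  refine ⟨(10 * σ ^ 2 - β ^ 2 + 8 * γ) ^ 3 -
    (35 * σ ^ 3 - 7 * (β ^ 2 - 8 * γ) * σ + β ^ 3 - 12 * β * γ + 72 * δ) ^ 2, ?_, ?_⟩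
  · -- the unit: a finite check over `ZMod 3`
    intro h3U
    have hrel : Y ^ 3 * (σ + β) + 16 * γ * Y ^ 2 + 192 * δ * Y + 256 * ε = 0 := by
      have h : (3 : ℤ) * (Y ^ 3 * (σ + β) + 16 * γ * Y ^ 2 + 192 * δ * Y + 256 * ε) = 0 := by
        linear_combination hYeq - Y ^ 3 * hσ
      exact (mul_eq_zero.mp h).resolve_left (by norm_num)
    refine unit_III_decide (β : ZMod 3) γ σ δ ε Y
      (by rwa [Ne, ZMod.intCast_zmod_eq_zero_iff_dvd]) (by rwa [Ne, ZMod.intCast_zmod_eq_zero_iff_dvd])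
      ?_ ?_ ?_ ?_
    · have h := congrArg (Int.cast : ℤ → ZMod 3) hσ; push_cast at h ⊢; linear_combination h
    · have h := congrArg (Int.cast : ℤ → ZMod 3) hε; push_cast at h ⊢; exact h
    · have h := congrArg (Int.cast : ℤ → ZMod 3) hrel; push_cast at h ⊢; exact h
    · have h := (ZMod.intCast_zmod_eq_zero_iff_dvd _ 3).mpr h3U; push_cast at h; exact h
  · intro T h4 h6
    have h := T.c_relation
    rw [h4, h6, hc₄, hc₆, hq'] at h
    push_cast
    linear_combination h / 27

/-- `ord₃ 64 = 0`. [elementary] -/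
private theorem padicValRat_three_sixtyfour : padicValRat 3 (64 : ℚ) = 0 := by
  rw [show (64 : ℚ) = ((64 : ℕ) : ℚ) by norm_num, padicValRat.of_nat]
  norm_cast
  exact padicValNat.eq_zero_of_not_dvd (by norm_num)

/-! ### §4. The law on the `III` stratum -/

/-- **E-an-107 `TameThreeNeronScalarLawIII`, conjunct 2 (cell bsd-f2-manin, MEMO-an §66; census 8 650 / 8 650 `III → III*`
rational `3`-isogenies at `v₃N = 2`, all `u = 1`): on a globally minimal `W/ℚ`, TAME at `3` (`9 ∥ N`) with `ord₃ Δ_min = 3`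
(type `III`), for every rational `3`-line (`Ψ₃(q − b₂/12) = 0`) every globally minimal `W'` with the `u = 1` Vélu pair
`c₄(W') = 1440q² − 9c₄(W)`, `c₆(W') = 60480q³ − 756c₄(W)q − 27c₆(W)` has `ord₃ Δ_min(W') = 9`** (the target is `III*`).
[cite: SilvermanATAEC1994, IV.9.4 Steps 2–4 and Table 4.1] [cite: SilvermanAEC2009, III.1 Table 3.1] -/
theorem padicValInt_minimalDiscriminantInt_eq_nine_of_velu_three_of_III (W : WeierstrassCurve ℚ) [W.IsElliptic]
    [W.IsGloballyMinimal] (h9 : 3 ^ 2 ∣ W.conductorNorm ℤ) (h27 : ¬ 3 ^ 3 ∣ W.conductorNorm ℤ)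
    (hΔ : padicValInt 3 W.minimalDiscriminantInt = 3) (q : ℚ) (hq : W.Ψ₃.eval (q - W.b₂ / 12) = 0)
    (W' : WeierstrassCurve ℚ) [W'.IsElliptic] [W'.IsGloballyMinimal]
    (h4 : W'.c₄ = 1440 * q ^ 2 - 9 * W.c₄) (h6 : W'.c₆ = 60480 * q ^ 3 - 756 * W.c₄ * q - 27 * W.c₆) :
    padicValInt 3 W'.minimalDiscriminantInt = 9 := by
  obtain ⟨U, hU3, hT⟩ := exists_unit_velu_three_Δ_of_III W h9 h27 hΔ q hq
  have hU0 : (U : ℚ) ≠ 0 := by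
    have : U ≠ 0 := fun h ↦ hU3 (h ▸ dvd_zero 3)
    exact_mod_cast this
  have hΔ' : (W'.minimalDiscriminantInt : ℚ) = 3 ^ 9 * (U : ℚ) / 64 := by
    rw [cast_minimalDiscriminantInt]; linear_combination hT W' h4 h6 / 64
  have h3v : padicValRat 3 (3 : ℚ) = 1 := by exact_mod_cast padicValRat.self (p := 3) (by norm_num)
  have hUv : padicValRat 3 (U : ℚ) = 0 := by rw [padicValRat.of_int, padicValInt.eq_zero_of_not_dvd hU3]; simp
  have hval : padicValRat 3 (W'.minimalDiscriminantInt : ℚ) = 9 := by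
    rw [hΔ', padicValRat.div (mul_ne_zero (pow_ne_zero _ three_ne_zero) hU0) (by norm_num),
      padicValRat.mul (pow_ne_zero _ three_ne_zero) hU0, padicValRat.pow (3 : ℚ), h3v, hUv,
      padicValRat_three_sixtyfour]
    simp
  rw [padicValRat.of_int] at hval
  exact_mod_cast hval

/-- **No globally minimal curve carries the `u = 3` pair on the `III` stratum** (E-an-107: `u(W → W/C) ≠ 3`): with `W`, `q`
as above there is no globally minimal `W'` with `3⁴c₄(W') = 1440q² − 9c₄(W)`, `3⁶c₆(W') = 60480q³ − 756c₄(W)q − 27c₆(W)`: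
the rescaling `(3⁻¹; 0, 0, 0) • W'` carries the Vélu pair, so `3¹²·64·Δ_min(W') = 3⁹·U`, `ord₃ Δ_min(W') = −3 < 0`.
[cite: SilvermanAEC2009, III.1 Table 3.1 and VII.1] -/
theorem not_exists_isGloballyMinimal_three_velu_three_of_III (W : WeierstrassCurve ℚ) [W.IsElliptic]
    [W.IsGloballyMinimal] (h9 : 3 ^ 2 ∣ W.conductorNorm ℤ) (h27 : ¬ 3 ^ 3 ∣ W.conductorNorm ℤ)
    (hΔ : padicValInt 3 W.minimalDiscriminantInt = 3) (q : ℚ) (hq : W.Ψ₃.eval (q - W.b₂ / 12) = 0) :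
    ¬ ∃ W' : WeierstrassCurve ℚ, W'.IsElliptic ∧ W'.IsGloballyMinimal ∧
        (3 : ℚ) ^ 4 * W'.c₄ = 1440 * q ^ 2 - 9 * W.c₄ ∧
        (3 : ℚ) ^ 6 * W'.c₆ = 60480 * q ^ 3 - 756 * W.c₄ * q - 27 * W.c₆ := by
  rintro ⟨W', _, _, h4, h6⟩
  obtain ⟨U, hU3, hT⟩ := exists_unit_velu_three_Δ_of_III W h9 h27 hΔ q hq
  -- the rescaled model `T = (3⁻¹; 0, 0, 0) • W'` carries the Vélu pair
  set C : VariableChange ℚ := ⟨Units.mk0 (3 : ℚ)⁻¹ (inv_ne_zero three_ne_zero), 0, 0, 0⟩ with hC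
  have hu : ((C.u⁻¹ : ℚˣ) : ℚ) = 3 := by rw [Units.val_inv_eq_inv_val, hC, Units.val_mk0, inv_inv]
  have hT4 : (C • W').c₄ = 1440 * q ^ 2 - 9 * W.c₄ := by rw [variableChange_c₄, hu, ← h4]
  have hT6 : (C • W').c₆ = 60480 * q ^ 3 - 756 * W.c₄ * q - 27 * W.c₆ := by rw [variableChange_c₆, hu, ← h6]
  have hTΔ : (C • W').Δ = 3 ^ 12 * (W'.minimalDiscriminantInt : ℚ) := by
    rw [variableChange_Δ, hu, cast_minimalDiscriminantInt]
  have h := hT (C • W') hT4 hT6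
  rw [hTΔ] at h
  -- valuations: `12 + ord₃ Δ_min(W') = 9`
  have hU0 : (U : ℚ) ≠ 0 := by
    have : U ≠ 0 := fun h ↦ hU3 (h ▸ dvd_zero 3)
    exact_mod_cast this
  have hm0 : (W'.minimalDiscriminantInt : ℚ) ≠ 0 := by exact_mod_cast minimalDiscriminantInt_ne_zero W'
  have h3v : padicValRat 3 (3 : ℚ) = 1 := by exact_mod_cast padicValRat.self (p := 3) (by norm_num)
  have hUv : padicValRat 3 (U : ℚ) = 0 := by rw [padicValRat.of_int, padicValInt.eq_zero_of_not_dvd hU3]; simp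
  have hl : padicValRat 3 (64 * (3 ^ 12 * (W'.minimalDiscriminantInt : ℚ))) =
      12 + padicValInt 3 W'.minimalDiscriminantInt := by
    rw [padicValRat.mul (by norm_num) (mul_ne_zero (pow_ne_zero _ three_ne_zero) hm0),
      padicValRat.mul (pow_ne_zero _ three_ne_zero) hm0, padicValRat.pow (3 : ℚ), h3v, padicValRat.of_int,
      padicValRat_three_sixtyfour]
    push_cast; ring
  have hr : padicValRat 3 (3 ^ 9 * (U : ℚ)) = 9 := by
    rw [padicValRat.mul (pow_ne_zero _ three_ne_zero) hU0, padicValRat.pow (3 : ℚ), h3v, hUv]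
    push_cast
  have hv := congrArg (padicValRat 3) h
  rw [hl, hr] at hv
  have hnn : (0 : ℤ) ≤ padicValInt 3 W'.minimalDiscriminantInt := Nat.cast_nonneg _
  omega

end Summit.BirchSwinnertonDyer.BirchSwinnertonDyer.Theorems.ManinLocalTwoThree

end
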